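import Mathlib
import Literature.Analysis.FluidPDE.ParabolicComparison
import Literature.Analysis.FluidPDE.SelfSimilarCollapseAnsatz
import HarnessLib

/-!
# Self-similar Boussinesq-type temperature profiles with diffusion: the floor `λ ≥ 1` (collapse exponent
# `γ ≥ 2`) for decaying profiles on the whole space, and the emptiness of the NS-type scaling

HONEST FRAMING (cell ns-blowup GROUP B «PROFILE SEARCH», zone Z3-b = «Chen–Hou 2-D Boussinesq toward NS-type
dissipation»; human rulings D-0035/D-0074): **MODEL / profile-system calculus; not Euler, not Navier–Stokes;
«violates: none — MODEL».** Companion of `HouLuoViscousThetaFloor.lean` (same directory, the 1-D Hou–Luo sheet);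
this file is the whole-space, any-dimension version of its temperature half. Nothing here asserts that any profile
exists, and nothing here is a statement about Navier–Stokes.

OBJECT. In the convention of Wang–Lai–Gómez-Serrano–Buckmaster 2023 (1.2)–(1.3) (tree
`Literature.Analysis.FluidPDE.IsSelfSimilarBoussinesqProfile`, inviscid, half plane): `u = (1−t)^λ U(y)`,
`θ = (1−t)^{λ−1} Θ(y)`, `y = x/(1−t)^{1+λ}`, collapse exponent `γ = 1 + λ` (`collapseExponent_wlgsb`). Adding a
temperature diffusion `κ_phys Δθ` and freezing its rescaled coefficient at `κ ≥ 0` (the cell's frozen-`ε` device,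
PROFILE-SPEC §5.2) the temperature profile equation on the WHOLE space `E` (any finite-dimensional real inner
product space; `E = ℝ²` is Boussinesq, the same scalar equation governs `(r u^θ)²`-type quantities in other models)
reads

  `(Θ-eq)   (1 − λ) Θ(y) + DΘ(y)[(1 + λ) y + U(y)] = κ ΔΘ(y)`      (hypothesis `∀ y, …` below; no new definition).

WHAT IS KERNEL-CHECKED (calculus only; `U` is an ARBITRARY drift — no incompressibility, no momentum equation):
* `one_sub_lam_mul_le_zero_of_isLocalMax` — at a local maximum `y*` of a `C²` solution, `DΘ(y*) = 0` and
  `ΔΘ(y*) ≤ 0` (tree `IsLocalMax.laplacian_nonpos`), so `(1 − λ) Θ(y*) = κ ΔΘ(y*) ≤ 0`; hence `λ ≥ 1` at a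
  positive maximum (`one_le_lam_of_isLocalMax_pos`) and at a negative minimum (`one_le_lam_of_isLocalMin_neg`).
* `theta_eq_zero_of_lam_lt_one` — **below the floor (`λ < 1`, i.e. `γ < 2`) every `C²` solution tending to `0`
  at infinity vanishes identically**; `one_le_lam` — a nontrivial decaying solution has `λ ≥ 1`, `γ = 1 + λ ≥ 2`.
* `theta_eq_zero_at_nsType_scaling` — constant viscosity/diffusivity is self-consistent with the ansatz iff
  `γ = ½` (`effectiveViscosity_half`), i.e. `λ = −½ < 1`: **no decaying temperature profile at the NS-type
  scaling**, whatever the drift; `two_le_collapseExponent` / `effectiveViscosity_tendsto_atTop` — every nontrivial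
  decaying profile has `γ ≥ 2 > ½`, so its constant-`ν` reading `ν_eff → +∞`.
CONSISTENCY WITH PRINT: Chen–Hou 2022 `c_l/|c_ω| ≈ 2.92 > 2` (tree `chenHou_collapseExponent`,
`half_lt_chenHou_collapseExponent`); the printed Boussinesq/Euler hierarchy `λ_n = 1/(1.4187n + 1.0863) + 1 > 1`
(`one_lt_boussinesqLambda`) sits above the floor and accumulates at it. Those printed profiles live on a half plane
with UNBOUNDED `Θ` (the inviscid equation forces `(1−λ)Θ(y*) = 0` at any extremum, cf.
`HouLuoViscousThetaFloor`/`BoussinesqThetaFloor.lam_eq_one_of_isLocalExtr`), so they are outside the decaying class —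
consistent, not contradicted. PRINTED PARENT: D. Chae, Comm. Math. Phys. 273 (2007) 203–215 (arXiv:math/0601060)
Thm 2.2/2.4 — inviscid transport, `Θ ∈ L^{p₁} ∩ L^{p₂}`; new here is only the diffusive one-sided pointwise version.
For constant `ν > 0` the 2-D Boussinesq system on `ℝ²` is globally regular in print (Hou–Li, DCDS 12 (2005) 1–12;
Chae, Adv. Math. 203 (2006) 497–513) — a stronger dynamical statement this file does not touch.
HYPOTHESES, PRINTED: `Θ ∈ C²(E)`, `Tendsto Θ (cocompact E) (𝓝 0)`, (Θ-eq) at every point, `κ ≥ 0`. bears_on: LADDER-NS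
N5 / zone Z3-b → N1 linear core; SELFSIM-NOGO (M8) MODEL side.
-/

noncomputable section
open Set Filter Topology InnerProductSpace
open scoped Laplacian

namespace Summit.NavierStokesRegularity.OSWSelfSimilar
namespace BoussinesqViscousThetaFloor

open Literature.Analysis.FluidPDE

variable {E : Type*} [NormedAddCommGroup E] [InnerProductSpace ℝ E] [FiniteDimensional ℝ E]

/-- The temperature profile equation `(1 − λ) Θ(y) + DΘ(y)[(1 + λ) y + U(y)] = κ ΔΘ(y)` (WLGSB 2023 convention
plus a frozen diffusion `κ`) is linear in `Θ`: `−Θ` solves it with the same drift. [new here — MODEL] -/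
theorem thetaEq_neg {κ lam : ℝ} {U : E → E} {Θ : E → ℝ}
    (h : ∀ y : E, (1 - lam) * Θ y + fderiv ℝ Θ y ((1 + lam) • y + U y) = κ * (Δ Θ) y) (y : E) :
    (1 - lam) * (fun y => -Θ y) y + fderiv ℝ (fun y => -Θ y) y ((1 + lam) • y + U y) =
      κ * (Δ (fun y => -Θ y)) y := by
  have hy := h y
  have hneg : (fun y => -Θ y) = -Θ := rfl
  have hΔ : (Δ (fun y => -Θ y)) y = -((Δ Θ) y) := by
    rw [hneg, InnerProductSpace.laplacian_neg]
    · rfl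
  have hD : fderiv ℝ (fun y => -Θ y) y ((1 + lam) • y + U y) = -(fderiv ℝ Θ y ((1 + lam) • y + U y)) := by
    rw [hneg, fderiv_neg]
    rfl
  rw [hΔ, hD]
  linarith

/-! ### The maximum principle at an extremum -/

/-- **At a local maximum: `(1 − λ) Θ(y*) ≤ 0`.** `DΘ(y*) = 0` (Fermat) and `ΔΘ(y*) ≤ 0` (tree
`IsLocalMax.laplacian_nonpos`), so (Θ-eq) gives `(1−λ)Θ(y*) = κΔΘ(y*) ≤ 0` for `κ ≥ 0`. [new here — MODEL] -/
theorem one_sub_lam_mul_le_zero_of_isLocalMax {κ lam : ℝ} {U : E → E} {Θ : E → ℝ} (hκ : 0 ≤ κ)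
    (h : ∀ y : E, (1 - lam) * Θ y + fderiv ℝ Θ y ((1 + lam) • y + U y) = κ * (Δ Θ) y) (hΘ : ContDiff ℝ 2 Θ) {y : E} (hmax : IsLocalMax Θ y) :
    (1 - lam) * Θ y ≤ 0 := by
  have hD : fderiv ℝ Θ y = 0 := hmax.fderiv_eq_zero
  have hΔ : (Δ Θ) y ≤ 0 := IsLocalMax.laplacian_nonpos hΘ hmax
  have hy : (1 - lam) * Θ y = κ * (Δ Θ) y := by simpa [hD] using h y
  rw [hy]
  exact mul_nonpos_of_nonneg_of_nonpos hκ hΔ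

/-- **Positive local maximum ⇒ `λ ≥ 1`.** [new here — MODEL] -/
theorem one_le_lam_of_isLocalMax_pos {κ lam : ℝ} {U : E → E} {Θ : E → ℝ} (hκ : 0 ≤ κ)
    (h : ∀ y : E, (1 - lam) * Θ y + fderiv ℝ Θ y ((1 + lam) • y + U y) = κ * (Δ Θ) y) (hΘ : ContDiff ℝ 2 Θ) {y : E} (hmax : IsLocalMax Θ y) (hpos : 0 < Θ y) :
    1 ≤ lam := by
  have := one_sub_lam_mul_le_zero_of_isLocalMax hκ h hΘ hmax
  by_contra hlt
  push Not at hlt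
  have : 0 < (1 - lam) * Θ y := mul_pos (by linarith) hpos
  linarith

/-- **Negative local minimum ⇒ `λ ≥ 1`** (previous lemma for `−Θ`). [new here — MODEL] -/
theorem one_le_lam_of_isLocalMin_neg {κ lam : ℝ} {U : E → E} {Θ : E → ℝ} (hκ : 0 ≤ κ)
    (h : ∀ y : E, (1 - lam) * Θ y + fderiv ℝ Θ y ((1 + lam) • y + U y) = κ * (Δ Θ) y) (hΘ : ContDiff ℝ 2 Θ) {y : E} (hmin : IsLocalMin Θ y) (hneg : Θ y < 0) :
    1 ≤ lam :=
  one_le_lam_of_isLocalMax_pos hκ (thetaEq_neg h) hΘ.neg hmin.neg (by linarith)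

/-! ### Decaying profiles -/

omit [InnerProductSpace ℝ E] [FiniteDimensional ℝ E] in
/-- A continuous function tending to `0` at infinity with a positive value has a positive local maximum.
[folklore] -/
theorem exists_isLocalMax_pos {f : E → ℝ} (hf : Continuous f) (h0 : Tendsto f (cocompact E) (𝓝 0))
    {x₀ : E} (hx₀ : 0 < f x₀) : ∃ x, IsLocalMax f x ∧ 0 < f x := by
  have hev : ∀ᶠ x in cocompact E, f x ≤ f x₀ := (h0.eventually (gt_mem_nhds hx₀)).mono fun x hx => hx.le
  obtain ⟨x, hx⟩ := hf.exists_forall_ge' x₀ hev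
  exact ⟨x, Filter.Eventually.of_forall fun y => hx y, lt_of_lt_of_le hx₀ (hx x₀)⟩

/-- **Below the floor the decaying class is empty.** If `λ < 1`, `κ ≥ 0`, `Θ ∈ C²` solves (Θ-eq) with some drift
`U` and tends to `0` at infinity, then `Θ = 0`. [new here — MODEL; printed parent Chae 2007 CMP 273 Thm 2.2
(inviscid, `L^{p₁} ∩ L^{p₂}`)] -/
theorem theta_eq_zero_of_lam_lt_one {κ lam : ℝ} {U : E → E} {Θ : E → ℝ} (hκ : 0 ≤ κ) (hlam : lam < 1)
    (h : ∀ y : E, (1 - lam) * Θ y + fderiv ℝ Θ y ((1 + lam) • y + U y) = κ * (Δ Θ) y) (hΘ : ContDiff ℝ 2 Θ) (h0 : Tendsto Θ (cocompact E) (𝓝 0)) : Θ = 0 := by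
  have hc : Continuous Θ := hΘ.continuous
  funext x₀
  by_contra hne
  rcases lt_or_gt_of_ne hne with hneg | hpos
  · have hc' : Continuous fun y => -Θ y := hc.neg
    have h0' : Tendsto (fun y => -Θ y) (cocompact E) (𝓝 0) := by simpa using h0.neg
    obtain ⟨x, hmax, hx⟩ := exists_isLocalMax_pos hc' h0' (x₀ := x₀) (by simpa using hneg)
    have h1 := one_le_lam_of_isLocalMax_pos hκ (thetaEq_neg h) hΘ.neg hmax hx
    linarith
  · obtain ⟨x, hmax, hx⟩ := exists_isLocalMax_pos hc h0 (x₀ := x₀) (by simpa using hpos)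
    have h1 := one_le_lam_of_isLocalMax_pos hκ h hΘ hmax hx
    linarith

/-- **THE FLOOR**: a nontrivial decaying `C²` solution of (Θ-eq) with `κ ≥ 0` has `λ ≥ 1`, i.e. collapse
exponent `γ = 1 + λ ≥ 2` (`two_le_collapseExponent`). [new here — MODEL] -/
theorem one_le_lam {κ lam : ℝ} {U : E → E} {Θ : E → ℝ} (hκ : 0 ≤ κ) (h : ∀ y : E, (1 - lam) * Θ y + fderiv ℝ Θ y ((1 + lam) • y + U y) = κ * (Δ Θ) y)
    (hΘ : ContDiff ℝ 2 Θ) (h0 : Tendsto Θ (cocompact E) (𝓝 0)) (hne : Θ ≠ 0) : 1 ≤ lam := by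
  by_contra hlt
  push Not at hlt
  exact hne (theta_eq_zero_of_lam_lt_one hκ hlt h hΘ h0)

/-- The floor in the tree's collapse-exponent convention: `γ = collapseExponent_wlgsb λ = 1 + λ ≥ 2`.
[new here — MODEL] -/
theorem two_le_collapseExponent {κ lam : ℝ} {U : E → E} {Θ : E → ℝ} (hκ : 0 ≤ κ) (h : ∀ y : E, (1 - lam) * Θ y + fderiv ℝ Θ y ((1 + lam) • y + U y) = κ * (Δ Θ) y)
    (hΘ : ContDiff ℝ 2 Θ) (h0 : Tendsto Θ (cocompact E) (𝓝 0)) (hne : Θ ≠ 0) :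
    2 ≤ collapseExponent_wlgsb lam := by
  have := one_le_lam hκ h hΘ h0 hne
  rw [collapseExponent_wlgsb]
  linarith

/-! ### The NS-type scaling -/

/-- **No decaying temperature profile at the NS-type scaling.** Constant viscosity/diffusivity is self-consistent
with the ansatz iff the collapse exponent is `½` (`effectiveViscosity_half`), i.e. `λ = −½` in the WLGSB convention
(`collapseExponent_wlgsb (−½) = ½`); since `−½ < 1`, every `C²` solution of (Θ-eq) with `κ ≥ 0` tending to `0` at
infinity is `0`, for every drift `U`. MODEL statement (Boussinesq-type temperature equation only). [new here — MODEL] -/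
theorem theta_eq_zero_at_nsType_scaling {κ : ℝ} {U : E → E} {Θ : E → ℝ} (hκ : 0 ≤ κ)
    (h : ∀ y : E, (1 - (-1 / 2 : ℝ)) * Θ y + fderiv ℝ Θ y ((1 + (-1 / 2 : ℝ)) • y + U y) = κ * (Δ Θ) y) (hΘ : ContDiff ℝ 2 Θ) (h0 : Tendsto Θ (cocompact E) (𝓝 0)) :
    Θ = 0 ∧ collapseExponent_wlgsb (-1 / 2) = 1 / 2 :=
  ⟨theta_eq_zero_of_lam_lt_one hκ (by norm_num) h hΘ h0, by rw [collapseExponent_wlgsb]; norm_num⟩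

/-- **The constant-`ν` reading of every nontrivial decaying profile diverges**: `γ = 1 + λ ≥ 2 > ½`, so
`ν_eff(t) = ν (T−t)^{1−2γ} → +∞` as `t ↑ T` for every `ν > 0` (tree
`tendsto_effectiveViscosity_atTop_of_half_lt`). [new here — MODEL] -/
theorem effectiveViscosity_tendsto_atTop {κ lam : ℝ} {U : E → E} {Θ : E → ℝ} (hκ : 0 ≤ κ)
    (h : ∀ y : E, (1 - lam) * Θ y + fderiv ℝ Θ y ((1 + lam) • y + U y) = κ * (Δ Θ) y) (hΘ : ContDiff ℝ 2 Θ) (h0 : Tendsto Θ (cocompact E) (𝓝 0)) (hne : Θ ≠ 0)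
    {ν : ℝ} (hν : 0 < ν) (T : ℝ) :
    Tendsto (effectiveViscosity ν (collapseExponent_wlgsb lam) T) (𝓝[<] T) atTop :=
  tendsto_effectiveViscosity_atTop_of_half_lt (by have := two_le_collapseExponent hκ h hΘ h0 hne; linarith) hν

/-- **Chen–Hou's exponent sits above the floor**: `chenHou_collapseExponent ≥ 2` is NOT claimed (it is `≈ 2.92`, a
printed number held in the tree as data); what the floor says is only the compatibility
`½ < 2 ≤ γ` for any decaying diffusive temperature profile, while the tree records `½ < chenHou_collapseExponent`
(`half_lt_chenHou_collapseExponent`). This lemma packages the two facts side by side for the census.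
[new here — MODEL] -/
theorem floor_and_chenHou {κ lam : ℝ} {U : E → E} {Θ : E → ℝ} (hκ : 0 ≤ κ) (h : ∀ y : E, (1 - lam) * Θ y + fderiv ℝ Θ y ((1 + lam) • y + U y) = κ * (Δ Θ) y)
    (hΘ : ContDiff ℝ 2 Θ) (h0 : Tendsto Θ (cocompact E) (𝓝 0)) (hne : Θ ≠ 0) :
    2 ≤ collapseExponent_wlgsb lam ∧ (1 : ℝ) / 2 < chenHou_collapseExponent :=
  ⟨two_le_collapseExponent hκ h hΘ h0 hne, half_lt_chenHou_collapseExponent⟩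

end BoussinesqViscousThetaFloor
end Summit.NavierStokesRegularity.OSWSelfSimilar
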